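import Summits.QuantumFields.BalabanUV.Gaps.D1PinnedResponseTowers
import Summits.QuantumFields.BalabanUV.Gaps.D1PinnedColourFreeCore
import Summits.QuantumFields.BalabanUV.Beta.FP.PerfectKernelSymm

/-!
# `BalabanUV.Gaps.D1PinnedIndexSymmetry` — cell pub-balaban-gaps, row (D1), seat g1-p1: THE PRINTED INDEX SYMMETRY (5.8) `Π_{μν}(z) = Π_{νμ}(−z)` IS A THEOREM FOR EVERY
# MEMBER OF THE β-LEAD's PINNED FAMILY `JsBalAn1(r; cE cVH cΛ; cE₂; cB; Tc)` — every box root, every colour triple, every `cE₂`, `cB`, `Tc`, every level `j` — hence every (1.22)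
# coefficient `β⁰_j`, its constructed limit, the binder (D1) itself and Engine C's response towers are CHANNEL-SYMMETRIC: `β⁰_j(μ,ν) = β⁰_j(ν,μ)`

HONEST FRAMING (cell rule, page 1 of everything): [folklore] kernel algebra BY NAME — road FP's generic transposition law `FP.PerfectKernelSymm.hessKer_swap` (leaf-02 gen 4: tadpole by
table symmetry + coarse covariance + `tadpole_shiftK`, bubble by the cyclic trace `RepAlgebraBubble.bubble_comm` + covariance + `bubble_shiftK`) fed with an4's `decays_KInvStep` ∕
`shiftK_KInvStep`, an2's `BalabanStepJetsSucc.vertexOfK_translate_block` ∕ `AxialDressing.dress_W` ∕ `BalabanStepW2.WbalOf_swap`, an1's plugged sockets `MixedJetTablesPlug.JsBalAn1_S_translate` ∕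
`JsBalAn1_W_translate`, the β sub-cell's `PolarizationSign.secondMoment_comm`, and GEN 12's `D1PinnedResponseTowers.secondMoment_JsBalAn1_dataDiff`.  NOTHING of Bałaban's asserted beyond
print: (5.8) p. 293 of [Balaban1987RG1] is a PRINTED IDENTITY about Bałaban's `Π`; what is proved here is that the cell's OWN typed object — the pinned literal — satisfies the typed
predicate `PolarizationSign.IndexSymmetric`, nothing about Bałaban's kernel; [Balaban1987RG1] Thm 2 UNPROVED IN PRINT; which member is print's ((P6)) NOT decided; NO coefficient
computed or signed; (D1) NOT discharged; 0∕4 row-D1 binders; NOT `BetaPertH`, NOT continuum, NOT Clay.  HONEST DEPENDENCY (b2b cell, verbatim): «continuum YM on T⁴ ⇐ BetaPertH ∧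
nine spine estimates (0/9 proved); BetaPertH ⇐ (D1) ∧ (D4) ∧ CAP+tail; G-an2-4 gates asym, D1 and NE2/3/4.»

WHY (census row 83 of `HOME/g1/RESIDUE.md`; Edison item (xi) of rows 81∕82).  Engine C's deposit `ttrl/balaban-calc/gaps/SIGMA-T1.md` (sha256 14e38c8e…8692) observes for the border tower
at `Lc = 3`, root `ctrOff 4 3`: `σ_j(1,0) = σ_j(0,1)` to 1e-10 at `j = 0, 1, 2`, and the exact torus identity `P₀₁(Z) = P₁₀(−Z)`.  THIS FILE makes that observation a kernel theorem
for the whole pinned family and every level, from three structural facts already in the tree: (i) an4's decimated composite resolvent `KInvStep Lc j` decays and is invariant under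
the coarse translations `Lc•t` of the step lattice; (ii) the literal's first-order stencils are block-covariant ((St♭), `JsBalAn1_S_translate`), so the chain-rule vertex family is
coarse-covariant (`vertexOfK_translate_block`); (iii) the literal's second-order tables are block-covariant ((Wt), `JsBalAn1_W_translate`) and SYMMETRIC under the swap of their two
coarse bonds (an2's swap-symmetrised carrier `W2SymOfK`, `WbalOf_swap`, through the dressing `dress_W`).  Road FP proved the same law for ITS literal `JsRowD1` (block-mean rooted,
co-dressed: `FP.RoadRowD1Slots.TbalOf_JsRowD1_swap`); the β-lead's axially dressed literal `JsBalAn1` at an arbitrary box root had no such theorem.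
CONSEQUENCES (hypothesis-free, every member): the (1.22) coefficient is symmetric in its channel (`secondMoment_TbalOf_JsBalAn1_comm`), so is its constructed limit
(`lim_secondMoment_JsBalAn1_comm`), the binder (D1) does not depend on the ORDER of the channel pair (`d1Drift_JsBalAn1_comm` — the wall's `(0,1)` and `(1,0)` are one statement), and
the pure-tadpole second moments of GEN 12's response towers (Engine C's `S_j(μ,ν)`; in particular the border tower `σ_j` and the table tower `λ_j`) are channel-symmetric at every
level (`secondMoment_dataDiff_comm`) — halving the channel bookkeeping of the compute targets T1–T4 of `HOME/g1/D1-PINNED-COMPUTE-TARGETS-g1p1.md`.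
CONTENT (all [folklore]; no `def`, no `def … : Prop`, 0 sorry): §1 `dress_W_swap`, **`JsBalAn1_W_swap`**; §2 **`TbalOf_JsBalAn1_swap`** (`TbalOf Lc (JsBalAn1 …) j a b t = TbalOf Lc (JsBalAn1 …) j b a (−t)`),
**`indexSymmetric_TbalOf_JsBalAn1`**, `indexSymmetric_flipK_TbalOf_JsBalAn1` (the printed-variable convention (R21) — the predicate is flip-invariant); §3 **`secondMoment_TbalOf_JsBalAn1_comm`**,
`lim_secondMoment_JsBalAn1_comm`, **`d1Drift_JsBalAn1_comm`**; §4 **`secondMoment_dataDiff_comm`**, `lim_dataDiff_comm`; §5 `tadpole_WbalT2Of_colourZero_swap` (the colour-free pure-tadpole word: Engine C's `P₀₁(Z) = P₁₀(−Z)` on `ℤ⁴`); §6 `ward_second_of_first_of_indexSymmetric` (generic: (5.8) transfers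
the Ward identity from the first to the second index), `ward_second_flipK_TbalOf_JsBalAn1_of_hW` (for the pinned literal the END's binder `hW` already gives BOTH identities of (5.9)).

ABSOLUTE RULE (cell charter, verbatim): «No internally-minted statement may enter as a cited fact. Every hypothesis is either kernel-proved in this
package or a verbatim quotation of a PUBLISHED theorem with page reference. The manuscript(s) under audit are NOT citable for their own disputed
steps — they are the thing under adjudication; programme-internal (2001/route/tribunal) claims are never citable.»

Provenance: cell pub-balaban-gaps, seat g1-p1 GEN 14 (prover-pub-balaban-gaps-g1-p1-g14-0), 2026-08-25; imports built modules only (`Gaps/D1PinnedResponseTowers` p380947 ✓,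
`Gaps/D1PinnedColourFreeCore` p372229 ✓, `Beta/FP/PerfectKernelSymm`); no existing file touched.
-/

noncomputable section

open Literature.MathematicalPhysics.QuantumFieldTheory Balaban1983to89 Balaban1983to89.Beta Filter Topology
open ExpKernelCalculus (MKer Decays BiLoc VertexFamily VertexFamily₂ hessKer tadpole shiftK)
open OneStepResolventKernel (Fib JetData)
open OneStepKernelFamily (KInvStep decays_KInvStep shiftK_KInvStep vertexOfK vertexFamily_vertexOfK' TbalOf TstepOf flipK D1Drift)
open PolarizationSign (IndexSymmetric WardTransversal secondMoment_comm)
open B6BondElimination (unitVec)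
open BalabanStepJetsSucc (JsBal0Of JsBal0Of_W vertexOfK_translate_block)
open BalabanStepW2 (WbalOf WbalOf_swap T2Of WbalT2Of)
open AffineAveraging (box toSite)
open AveragingMixedJetTables (vh₂SAt mixFFAt)
open RateCertificate (CauchyRate)
open AxialDressing (axDressK dress dress_W dressK)
open Summit.QuantumFields.BalabanUV.Beta.TameKernelCalculus (decays_of_le biLoc_of_le)
open Summit.QuantumFields.BalabanUV.Beta.MixedJetTablesPlug (JsBalAn1 JsBalAn1_S_translate JsBalAn1_W_translate)
open Summit.QuantumFields.BalabanUV.Beta.FP.PerfectKernelSymm (hessKer_swap)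
open Summit.QuantumFields.BalabanUV.Beta.GAN24.T2RecursionAffine (vsym)
open Summit.QuantumFields.BalabanUV.Beta.GAN24.StencilSlotOfE3 (one_le_of_two_le)
open Summit.QuantumFields.BalabanUV.Gaps.D1PinnedResponseTowers (secondMoment_JsBalAn1_dataDiff)
open Summit.QuantumFields.BalabanUV.Gaps.D1PinnedColourFreeCore (TbalOf_JsBalAn1_colourZero)

namespace Summit.QuantumFields.BalabanUV.Gaps.D1PinnedIndexSymmetry

/-! ## §1 The second-order tables of the literal are symmetric under the swap of their two coarse bonds -/

section Swap

variable {d : ℕ} {N : ℕ} [NeZero N]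

/-- [folklore] The axial dressing `dress` acts on the second-order tables entrywise (`dress_W`), so it PRESERVES the bond-swap symmetry of a table family. -/
theorem dress_W_swap (J : JetData d N) (hJ : ∀ (μ : Fin (d + 1)) (y : Fin (d + 1) → ℤ) (ν : Fin (d + 1)) (y' : Fin (d + 1) → ℤ), J.W μ y ν y' = J.W ν y' μ y)
    (μ : Fin (d + 1)) (y : Fin (d + 1) → ℤ) (ν : Fin (d + 1)) (y' : Fin (d + 1) → ℤ) :
    (dress J).W μ y ν y' = (dress J).W ν y' μ y := by
  rw [dress_W, dress_W, hJ]

end Swap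

section Pinned

variable {Lc : ℕ} [NeZero Lc] {r : Fin (3 + 1) → ℕ}

/-- [folklore] **BOND-SWAP SYMMETRY OF THE PINNED LITERAL's SECOND-ORDER TABLES** (every member, every colour, any root): `(JsBalAn1 … j).W μ y ν y′ = (JsBalAn1 … j).W ν y′ μ y` —
the literal is `dress ∘ JsBal⁰` with tables `WbalT2Of … j = W2SymOfK …` (an2's swap-symmetrised carrier, `WbalOf_swap`), and the dressing acts entrywise (`dress_W_swap`). -/
theorem JsBalAn1_W_swap (hLc : 1 ≤ Lc) (hr : r ∈ box (3 + 1) Lc) (cE cVH cΛ cE₂ cB : ℝ) (T : Fin 4 → Fin 4 → Fin 4 → Fin 4 → ℝ) (j : ℕ)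
    (μ : Fin (3 + 1)) (y : Fin (3 + 1) → ℤ) (ν : Fin (3 + 1)) (y' : Fin (3 + 1) → ℤ) :
    (JsBalAn1 hLc hr cE cVH cΛ cE₂ cB T j).W μ y ν y' = (JsBalAn1 hLc hr cE cVH cΛ cE₂ cB T j).W ν y' μ y := by
  refine dress_W_swap _ (fun μ y ν y' => ?_) μ y ν y'
  rw [JsBal0Of_W]
  exact (WbalOf_swap cE cVH cΛ _ _ j μ y ν y').symm

/-! ## §2 (5.8) for the pinned literal: `TbalOf Lc (JsBalAn1 …) j a b t = TbalOf Lc (JsBalAn1 …) j b a (−t)` -/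

/-- [folklore] **THE TRANSPOSITION ∕ INDEX SYMMETRY OF EVERY STEP KERNEL OF THE PINNED FAMILY** (any box root `r`, any colour triple, any `cE₂`, `cB`, `Tc`, every level `j`, no hypothesis):
`TbalOf Lc (JsBalAn1 …) j a b t = TbalOf Lc (JsBalAn1 …) j b a (−t)`.  PROOF: `TbalOf Lc Js j` IS `hessKer (KInvStep Lc j) (vertexOfK (KInvStep Lc j) Lc (Js j).S) (Js j).W` by definition;
road FP's `hessKer_swap` with (i) `decays_KInvStep` ∕ `shiftK_KInvStep`, (ii) `vertexFamily_vertexOfK'` + `vertexOfK_translate_block` over `JsBalAn1_S_translate`, (iii) `JsBalAn1_W_translate` +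
`JsBalAn1_W_swap`, at the common rate `min δK δv`. -/
theorem TbalOf_JsBalAn1_swap (hLc : 1 ≤ Lc) (hr : r ∈ box (3 + 1) Lc) (cE cVH cΛ cE₂ cB : ℝ) (T : Fin 4 → Fin 4 → Fin 4 → Fin 4 → ℝ) (j : ℕ)
    (a b : Fin (3 + 1)) (t : Fin (3 + 1) → ℤ) :
    TbalOf Lc (JsBalAn1 hLc hr cE cVH cΛ cE₂ cB T) j a b t = TbalOf Lc (JsBalAn1 hLc hr cE cVH cΛ cE₂ cB T) j b a (-t) := by
  obtain ⟨δK, C, hδK, hC, hK⟩ := decays_KInvStep (d := 3) (Lc := Lc) j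
  obtain ⟨Cv, δv, hδv, hV⟩ := vertexFamily_vertexOfK' (N := Lc) ⟨δK, C, hδK, hC, hK⟩ (JsBalAn1 hLc hr cE cVH cΛ cE₂ cB T j).loc
    (JsBalAn1 hLc hr cE cVH cΛ cE₂ cB T j).δ_pos
  have hm : 0 < min δK δv := lt_min hδK hδv
  have hA : Decays (KInvStep (d := 3) Lc j) (|C|) (min δK δv) := decays_of_le hK (min_le_left δK δv)
  have hV' : VertexFamily (vertexOfK (KInvStep (d := 3) Lc j) Lc (JsBalAn1 hLc hr cE cVH cΛ cE₂ cB T j).S) Lc (|Cv|) (min δK δv) :=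
    fun μ y => biLoc_of_le (hV μ y) (min_le_right δK δv)
  have hVcov : ∀ (μ : Fin (3 + 1)) (y s : Fin (3 + 1) → ℤ),
      vertexOfK (KInvStep (d := 3) Lc j) Lc (JsBalAn1 hLc hr cE cVH cΛ cE₂ cB T j).S μ (y + s) =
        shiftK (-((Lc : ℤ) • s)) (vertexOfK (KInvStep (d := 3) Lc j) Lc (JsBalAn1 hLc hr cE cVH cΛ cE₂ cB T j).S μ y) :=
    fun μ y s => vertexOfK_translate_block (fun s => shiftK_KInvStep (d := 3) (Lc := Lc) j s)
      (fun κ u s => JsBalAn1_S_translate hLc hr cE cVH cΛ cE₂ cB T j κ u s) μ y s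
  exact hessKer_swap hA hm (fun s => shiftK_KInvStep (d := 3) (Lc := Lc) j s) hV' hVcov
    (fun μ y ν y' s => JsBalAn1_W_translate hLc hr cE cVH cΛ cE₂ cB T j μ y ν y' s)
    (fun μ y ν y' => JsBalAn1_W_swap hLc hr cE cVH cΛ cE₂ cB T j μ y ν y') a b t

/-- [folklore] **THE PRINTED PREDICATE (5.8) HOLDS FOR EVERY STEP KERNEL OF THE PINNED FAMILY**: `IndexSymmetric (TbalOf Lc (JsBalAn1 …) j)` (`PolarizationSign.IndexSymmetric P :=
∀ μ ν x, P μ ν x = P ν μ (−x)` — the typed form of [Balaban1987RG1] (5.8) p. 293 «Π_{μν}(x) = Π_{νμ}(−x)», here a THEOREM about the cell's own object, not a statement about Bałaban's `Π`). -/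
theorem indexSymmetric_TbalOf_JsBalAn1 (hLc : 1 ≤ Lc) (hr : r ∈ box (3 + 1) Lc) (cE cVH cΛ cE₂ cB : ℝ) (T : Fin 4 → Fin 4 → Fin 4 → Fin 4 → ℝ) (j : ℕ) :
    IndexSymmetric (TbalOf Lc (JsBalAn1 hLc hr cE cVH cΛ cE₂ cB T) j) :=
  fun μ ν x => TbalOf_JsBalAn1_swap hLc hr cE cVH cΛ cE₂ cB T j μ ν x

/-- [folklore] The same for the FLIPPED kernels `flipK (TbalOf …) j` of the printed-variable convention (RULING (R21): the `hessKer` families are read at `−z`) — the predicate (5.8) is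
invariant under `z ↦ −z`, so no convention question arises for it. -/
theorem indexSymmetric_flipK_TbalOf_JsBalAn1 (hLc : 1 ≤ Lc) (hr : r ∈ box (3 + 1) Lc) (cE cVH cΛ cE₂ cB : ℝ) (T : Fin 4 → Fin 4 → Fin 4 → Fin 4 → ℝ) (j : ℕ) :
    IndexSymmetric (flipK (TbalOf Lc (JsBalAn1 hLc hr cE cVH cΛ cE₂ cB T) j)) := by
  intro μ ν x
  simp only [OneStepKernelFamily.flipK_apply, neg_neg]
  have h := TbalOf_JsBalAn1_swap hLc hr cE cVH cΛ cE₂ cB T j μ ν (-x)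
  rwa [neg_neg] at h

/-! ## §3 Channel symmetry of the (1.22) coefficients, of their constructed limit, and of the binder (D1) -/

/-- [folklore] **EVERY (1.22) COEFFICIENT OF THE PINNED FAMILY IS SYMMETRIC IN ITS CHANNEL**: `β⁰_j(μ,ν) = β⁰_j(ν,μ)`, i.e.
`secondMoment (TbalOf Lc (JsBalAn1 …) j) μ ν = secondMoment (TbalOf Lc (JsBalAn1 …) j) ν μ` — (5.8) + re-indexing `x ↦ −x` (`PolarizationSign.secondMoment_comm`; no summability needed). -/
theorem secondMoment_TbalOf_JsBalAn1_comm (hLc : 1 ≤ Lc) (hr : r ∈ box (3 + 1) Lc) (cE cVH cΛ cE₂ cB : ℝ) (T : Fin 4 → Fin 4 → Fin 4 → Fin 4 → ℝ) (j : ℕ) (μ ν : Fin 4) :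
    B12Beta.secondMoment (TbalOf Lc (JsBalAn1 hLc hr cE cVH cΛ cE₂ cB T) j) μ ν = B12Beta.secondMoment (TbalOf Lc (JsBalAn1 hLc hr cE cVH cΛ cE₂ cB T) j) ν μ :=
  secondMoment_comm (indexSymmetric_TbalOf_JsBalAn1 hLc hr cE cVH cΛ cE₂ cB T j) μ ν

/-- [folklore] The whole SEQUENCE of (1.22) coefficients is channel-symmetric (`funext`). -/
theorem secondMoment_TbalOf_JsBalAn1_comm_fun (hLc : 1 ≤ Lc) (hr : r ∈ box (3 + 1) Lc) (cE cVH cΛ cE₂ cB : ℝ) (T : Fin 4 → Fin 4 → Fin 4 → Fin 4 → ℝ) (μ ν : Fin 4) :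
    (fun j => B12Beta.secondMoment (TbalOf Lc (JsBalAn1 hLc hr cE cVH cΛ cE₂ cB T) j) μ ν) =
      fun j => B12Beta.secondMoment (TbalOf Lc (JsBalAn1 hLc hr cE cVH cΛ cE₂ cB T) j) ν μ :=
  funext fun j => secondMoment_TbalOf_JsBalAn1_comm hLc hr cE cVH cΛ cE₂ cB T j μ ν

/-- [folklore] **THE CONSTRUCTED LIMIT COEFFICIENT IS CHANNEL-SYMMETRIC** (any `cE₂`, in particular the pin `cE₂ := Lc^8`): `lim β⁰(r,c⃗;cB,Tc)(μ,ν) = lim β⁰(r,c⃗;cB,Tc)(ν,μ)` — so the four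
universal pieces `γ_r`, `Φ`, `σ_r`, `Λ` of the sibling files, all differences ∕ values of such limits, are channel-symmetric. -/
theorem lim_secondMoment_JsBalAn1_comm (hLc : 1 ≤ Lc) (hr : r ∈ box (3 + 1) Lc) (cE cVH cΛ cE₂ cB : ℝ) (T : Fin 4 → Fin 4 → Fin 4 → Fin 4 → ℝ) (μ ν : Fin 4) :
    CauchyRate.lim (fun j => B12Beta.secondMoment (TbalOf Lc (JsBalAn1 hLc hr cE cVH cΛ cE₂ cB T) j) μ ν) =
      CauchyRate.lim (fun j => B12Beta.secondMoment (TbalOf Lc (JsBalAn1 hLc hr cE cVH cΛ cE₂ cB T) j) ν μ) := by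
  rw [secondMoment_TbalOf_JsBalAn1_comm_fun]

/-- [folklore] **THE BINDER (D1) AT THE PINNED LITERAL DOES NOT DEPEND ON THE ORDER OF THE CHANNEL PAIR**: `D1Drift Lc (JsBalAn1 …) N μ ν ↔ D1Drift Lc (JsBalAn1 …) N ν μ` (every
member, every numeral `N`) — the wall's channel `(0,1)` and the channel `(1,0)` are one statement. -/
theorem d1Drift_JsBalAn1_comm (hLc : 1 ≤ Lc) (hr : r ∈ box (3 + 1) Lc) (cE cVH cΛ cE₂ cB : ℝ) (T : Fin 4 → Fin 4 → Fin 4 → Fin 4 → ℝ) (N : ℝ) (μ ν : Fin 4) :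
    D1Drift Lc (JsBalAn1 hLc hr cE cVH cΛ cE₂ cB T) N μ ν ↔ D1Drift Lc (JsBalAn1 hLc hr cE cVH cΛ cE₂ cB T) N ν μ := by
  unfold OneStepKernelFamily.D1Drift
  rw [secondMoment_TbalOf_JsBalAn1_comm_fun]

/-! ## §4 Channel symmetry of the response towers (Engine C's `S_j(μ,ν)`) -/

/-- [folklore] **THE PURE-TADPOLE SECOND MOMENTS OF THE RESPONSE TOWERS ARE CHANNEL-SYMMETRIC AT EVERY LEVEL** (any two members with the same colour triple and data `(cB,Tc)`, `(cB′,Tc′)`; any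
`cE₂`; no hypothesis): with `D_j := T2Of(c⃗; cB, Tc) j − T2Of(c⃗; cB′, Tc′) j`,
`secondMoment (½·tadpole (axDressK Lc (KInvStep Lc j)) (vsym (KInvStep Lc j) Lc D_j (μ,0;ν,z))) μ ν = (same) ν μ` — GEN 12's `secondMoment_JsBalAn1_dataDiff` (the tower's second moment IS
`β⁰_j(cB,Tc) − β⁰_j(cB′,Tc′)`) + §3 twice.  At `(cB,Tc;cB′,Tc′) = (1,Tc;0,Tc)` this is Engine C's border tower `σ_j(μ,ν) = σ_j(ν,μ)` (observed to 1e-10 at `j = 0,1,2` in `SIGMA-T1.md`), at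
`(cB,Tc;cB,0)` the table tower. -/
theorem secondMoment_dataDiff_comm (hLc : 1 ≤ Lc) (hr : r ∈ box (3 + 1) Lc) (cE cVH cΛ cE₂ cB cB' : ℝ) (T T' : Fin 4 → Fin 4 → Fin 4 → Fin 4 → ℝ) (j : ℕ) (μ ν : Fin 4) :
    B12Beta.secondMoment (fun μ ν z => (1 / 2) * tadpole (axDressK Lc (KInvStep (d := 3) Lc j)) (vsym (KInvStep (d := 3) Lc j) Lc
        (T2Of 3 Lc cE cVH cΛ cE₂ cB T (vh₂SAt (toSite r) Lc) (mixFFAt (toSite r) Lc) j - T2Of 3 Lc cE cVH cΛ cE₂ cB' T' (vh₂SAt (toSite r) Lc) (mixFFAt (toSite r) Lc) j) μ 0 ν z)) μ ν =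
      B12Beta.secondMoment (fun μ ν z => (1 / 2) * tadpole (axDressK Lc (KInvStep (d := 3) Lc j)) (vsym (KInvStep (d := 3) Lc j) Lc
        (T2Of 3 Lc cE cVH cΛ cE₂ cB T (vh₂SAt (toSite r) Lc) (mixFFAt (toSite r) Lc) j - T2Of 3 Lc cE cVH cΛ cE₂ cB' T' (vh₂SAt (toSite r) Lc) (mixFFAt (toSite r) Lc) j) μ 0 ν z)) ν μ := by
  rw [← secondMoment_JsBalAn1_dataDiff hLc hr cE cVH cΛ cE₂ cB cB' T T' j μ ν, ← secondMoment_JsBalAn1_dataDiff hLc hr cE cVH cΛ cE₂ cB cB' T T' j ν μ,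
    secondMoment_TbalOf_JsBalAn1_comm hLc hr cE cVH cΛ cE₂ cB T j μ ν, secondMoment_TbalOf_JsBalAn1_comm hLc hr cE cVH cΛ cE₂ cB' T' j μ ν]

/-- [folklore] **THE LIMIT RESPONSES ARE CHANNEL-SYMMETRIC** (any `cE₂`; in particular at the pin the border slope `σ_r(μ,ν) := lim β⁰(r,c⃗;1,Tc) − lim β⁰(r,c⃗;0,Tc)` and the table response
`λ(Tc)(μ,ν) := lim β⁰(r,c⃗;cB,Tc) − lim β⁰(r,c⃗;cB,0)` satisfy `σ_r(μ,ν) = σ_r(ν,μ)`, `λ(Tc)(μ,ν) = λ(Tc)(ν,μ)`): `lim β⁰(cB,Tc)(μ,ν) − lim β⁰(cB′,Tc′)(μ,ν) = lim β⁰(cB,Tc)(ν,μ) − lim β⁰(cB′,Tc′)(ν,μ)`. -/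
theorem lim_dataDiff_comm (hLc : 1 ≤ Lc) (hr : r ∈ box (3 + 1) Lc) (cE cVH cΛ cE₂ cB cB' : ℝ) (T T' : Fin 4 → Fin 4 → Fin 4 → Fin 4 → ℝ) (μ ν : Fin 4) :
    CauchyRate.lim (fun j => B12Beta.secondMoment (TbalOf Lc (JsBalAn1 hLc hr cE cVH cΛ cE₂ cB T) j) μ ν) -
        CauchyRate.lim (fun j => B12Beta.secondMoment (TbalOf Lc (JsBalAn1 hLc hr cE cVH cΛ cE₂ cB' T') j) μ ν) =
      CauchyRate.lim (fun j => B12Beta.secondMoment (TbalOf Lc (JsBalAn1 hLc hr cE cVH cΛ cE₂ cB T) j) ν μ) -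
        CauchyRate.lim (fun j => B12Beta.secondMoment (TbalOf Lc (JsBalAn1 hLc hr cE cVH cΛ cE₂ cB' T') j) ν μ) := by
  rw [lim_secondMoment_JsBalAn1_comm hLc hr cE cVH cΛ cE₂ cB T μ ν, lim_secondMoment_JsBalAn1_comm hLc hr cE cVH cΛ cE₂ cB' T' μ ν]

/-! ## §5 The colour-free members: Engine C's torus identity `P_{μν}(Z) = P_{νμ}(−Z)` for the PURE-TADPOLE word -/

/-- [folklore] **THE PURE-TADPOLE WORD OF THE COLOUR-FREE MEMBERS IS INDEX-SYMMETRIC** (any root, `cE₂`, `cB`, `Tc`, level, channel pair, site): with `W_j := WbalT2Of 0 0 0 cE₂ cB Tc … j`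
(an1's rooted tables plugged in), `tadpole (axDressK Lc (KInvStep Lc j)) (W_j μ 0 ν z) = tadpole (axDressK Lc (KInvStep Lc j)) (W_j ν 0 μ (−z))` — GEN 10's `TbalOf_JsBalAn1_colourZero` (the
colour-free step kernel IS `½·` this tadpole) on both sides of §2.  This is the identity `P₀₁(Z) = P₁₀(−Z)` that Engine C verified on the torus to 3e-21 (`SIGMA-T1.md` §4 (0i)), as a theorem on `ℤ⁴`. -/
theorem tadpole_WbalT2Of_colourZero_swap (hLc : 1 ≤ Lc) (hr : r ∈ box (3 + 1) Lc) (cE₂ cB : ℝ) (T : Fin 4 → Fin 4 → Fin 4 → Fin 4 → ℝ) (j : ℕ)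
    (μ ν : Fin 4) (z : Fin 4 → ℤ) :
    tadpole (axDressK Lc (KInvStep (d := 3) Lc j))
        (WbalT2Of (Lc := Lc) 0 0 0 cE₂ cB T (vh₂S := vh₂SAt (toSite r) Lc) (mixFF := mixFFAt (toSite r) Lc) j μ 0 ν z) =
      tadpole (axDressK Lc (KInvStep (d := 3) Lc j))
        (WbalT2Of (Lc := Lc) 0 0 0 cE₂ cB T (vh₂S := vh₂SAt (toSite r) Lc) (mixFF := mixFFAt (toSite r) Lc) j ν 0 μ (-z)) := by
  have h := TbalOf_JsBalAn1_swap hLc hr 0 0 0 cE₂ cB T j μ ν z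
  rw [TbalOf_JsBalAn1_colourZero, TbalOf_JsBalAn1_colourZero] at h
  linarith

/-! ## §6 Under the wall's Ward binder `hW` (the FIRST identity of (5.9)) the SECOND identity of (5.9) follows from (5.8) -/

/-- [folklore] **(5.8) TRANSFERS THE WARD IDENTITY FROM THE FIRST TO THE SECOND INDEX** (generic, any kernel, no summability): if `P` is transversal in its first index
(`PolarizationSign.WardTransversal P`: `Σ_μ (P_{μν}(z − e_μ) − P_{μν}(z)) = 0`, the typed first identity of [Balaban1987RG1] (5.9) p. 293) and index-symmetric ((5.8)), then it is
transversal in its SECOND index: `Σ_ν (P_{μν}(z + e_ν) − P_{μν}(z)) = 0` — the second identity «Σ_ν ∂_ν Π_{μν} = 0» of (5.9), which `Beta.KernelWard` records as NOT derived there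
(«it would follow … from index symmetry»). -/
theorem ward_second_of_first_of_indexSymmetric {d : ℕ} {P : B12Beta.Kernel d} (hT : WardTransversal P) (hS : IndexSymmetric P) (μ : Fin d) (z : Fin d → ℤ) :
    ∑ ν, (P μ ν (z + unitVec ν) - P μ ν z) = 0 := by
  have h := hT μ (-z)
  calc ∑ ν, (P μ ν (z + unitVec ν) - P μ ν z) = ∑ ν, (P ν μ (-z - unitVec ν) - P ν μ (-z)) := by
        refine Finset.sum_congr rfl fun ν _ => ?_
        rw [hS μ ν (z + unitVec ν), hS μ ν z, neg_add']
    _ = 0 := h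

/-- [folklore] **FOR THE PINNED LITERAL THE WALL's BINDER `hW` ALREADY GIVES BOTH IDENTITIES OF (5.9)**: if `flipK (TbalOf Lc (JsBalAn1 …) j)` is Ward-transversal in its first index (the END's
displayed binder `hW`, RULING (R21) convention), then it is transversal in its second index too — by §2's theorem (5.8), at no extra cost. -/
theorem ward_second_flipK_TbalOf_JsBalAn1_of_hW (hLc : 1 ≤ Lc) (hr : r ∈ box (3 + 1) Lc) (cE cVH cΛ cE₂ cB : ℝ) (T : Fin 4 → Fin 4 → Fin 4 → Fin 4 → ℝ) (j : ℕ)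
    (hW : WardTransversal (flipK (TbalOf Lc (JsBalAn1 hLc hr cE cVH cΛ cE₂ cB T) j))) (μ : Fin 4) (z : Fin 4 → ℤ) :
    ∑ ν, (flipK (TbalOf Lc (JsBalAn1 hLc hr cE cVH cΛ cE₂ cB T) j) μ ν (z + unitVec ν) - flipK (TbalOf Lc (JsBalAn1 hLc hr cE cVH cΛ cE₂ cB T) j) μ ν z) = 0 :=
  ward_second_of_first_of_indexSymmetric hW (indexSymmetric_flipK_TbalOf_JsBalAn1 hLc hr cE cVH cΛ cE₂ cB T j) μ z

end Pinned

end Summit.QuantumFields.BalabanUV.Gaps.D1PinnedIndexSymmetry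

end
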